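import Literature.LinearAlgebra.QuadraticForm.LorentzianReverseSchwarz
import Literature.Topology.FourManifolds.LatticeFormsOrthoSumSignature
import Mathlib.LinearAlgebra.Matrix.BilinearForm
import HarnessLib

/-!
# Forms with at most one positive square: monotonicity, isotropic vectors, sums sharing an isotropic
# vector, closedness under limits `ε → 0⁺`, and the bordered matrix `[[H, Ha], [(Ha)ᵀ, 0]]`
# (the linear algebra of Brändén–Huh 2020, Lemma 2.9 (1), (4) and "stability is a closed condition",
# for quadratic forms)

Topic `Literature/LinearAlgebra/QuadraticForm`, namespace `Literature.LinearAlgebra.QuadraticForm`; lane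
`lit-hodgefound` (Track 2 foundations library), seat p16, generation 28 (row g28-#1). Theorems and two auxiliary
definitions with bodies (`bordered`, `borderMap`); no named fact (net debt 0). This is the signature engine behind the
seat's formalization of Brändén–Huh's Theorem 2.10 / Corollary 2.11 / Theorem 2.16 (2) (nonnegative linear changes of
variables and nonnegative directional derivatives preserve Lorentzian polynomials; the Hessian of a Lorentzian
polynomial has exactly one positive eigenvalue on the positive orthant): Brändén–Huh argue with STABLE polynomials and
the interlacing relation `f ≺ g` ("`g + w_{n+1} f` is stable"); for the quadratic forms `∂^α f`, `|α| = d - 2`, to which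
Definition 2.6 reduces everything, "stable with nonnegative coefficients" is "at most one positive eigenvalue" (Lemma 2.5,
tree `mem_lorentzian_two_iff_isRealStable`), and the three facts used — Lemma 2.9 (1) `∂_j f ≺ f`, Lemma 2.9 (4)
`f ≺ g₁, f ≺ g₂ ⟹ f ≺ θ₁ g₁ + θ₂ g₂`, and "stability is a closed condition" — become the statements of §§5, 3, 4 below
about real symmetric bilinear forms.

## Sources

* [BrandenHuh2019] P. Brändén, J. Huh, *Lorentzian polynomials*, Ann. of Math. 192 (2020), arXiv:1902.03719 (held
  `paper:arxiv-1902.03719`), §2.2: "For stable polynomials `f` and `g` […] we define a relation `f ≺ g` by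
  `f ≺ g ⟺ g + w_{n+1} f` is a stable polynomial"; **Lemma 2.9** "Let `f, g_1, g_2, h_1, h_2` be stable polynomials
  satisfying `h_1 ≺ f ≺ g_1` and `h_2 ≺ f ≺ g_2`. (1) The derivative `∂_1 f` is stable and `∂_1 f ≺ f`. […] (4) If `f` is
  not identically zero, then `f ≺ θ_1 g_1 + θ_2 g_2` for any `θ_1, θ_2 ≥ 0`."; proof of Prop. 2.7: "Since stability is a
  closed condition, it follows that `lim_{s → 0} […]` is stable".
* [ShenfeldVanHandel2019] Y. Shenfeld, R. van Handel, *Mixed volumes and the Bochner method*, Proc. AMS 147 (2019),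
  Lemma 2.9: "(2) There exists a vector `w` such that `⟨x,Ax⟩ ≤ 0` for all `x` such that `⟨x,Aw⟩ = 0`. (3) The positive
  eigenspace of `A` has dimension at most one." — the tree's `sigPos_le_one_of_orthogonal_nonpos` /
  `not_self_pos_of_orthogonal_of_self_pos` (`LorentzianReverseSchwarz`), used by name.
* [Serre1973] J.-P. Serre, *A Course in Arithmetic*, Ch. V §1.3.2 (the index of a pulled-back form) — the tree's
  `LinearMap.BilinForm.sigPos_le_sigPos_of_comp` (`LatticeFormsOrthoSumSignature`), used by name.

## What is proved (`V` finite-dimensional real, `B, B₁, B₂, N : LinearMap.BilinForm ℝ V`, `Q = B.toQuadraticMap`)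

* §1 `sigPos_mono` (`B₁ x x ≤ B₂ x x` for all `x` ⟹ `sigPos B₁ ≤ sigPos B₂`), `sigPos_smul_of_pos`.
* §2 **`self_nonpos_of_orthogonal_isotropic`**: if `sigPos Q ≤ 1`, `B e e = 0` and the functional `B · e` is not zero,
  then `B z z ≤ 0` on the hyperplane `B z e = 0` (Shenfeld–van Handel (3) ⟹ (2) with an ISOTROPIC `w = e`).
* §3 **`sigPos_add_le_one_of_isotropic`** (Lemma 2.9 (4) for quadratic forms): two symmetric forms with at most one
  positive square, a common isotropic vector `e` and the same nonzero functional `B₁ · e = B₂ · e`, have a sum with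
  at most one positive square.
* §4 **`sigPos_le_one_of_forall_pos_add_smul`** ("stability is a closed condition", quadratic case): if
  `sigPos (B + ε N) ≤ 1` for every `ε > 0` then `sigPos B ≤ 1`.
* §5 the bordered matrix `bordered H u = [[H, u], [uᵀ, 0]]` on `Option σ` and **`sigPos_bordered_mulVec_le`** (Lemma 2.9
  (1) for a quadratic form `q = ½ xᵀHx` and the linear form `D_a q = (Ha)ᵀx`, i.e. "`D_a q ≺ q`"):
  `sigPos [[H, Ha], [(Ha)ᵀ, 0]] ≤ sigPos H` whenever `aᵀHa ≥ 0`; `toBilin'_bordered` (its quadratic form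
  `xᵀHx' + t' uᵀx + t uᵀx'`), `sigPos_submatrix_some_le` (`sigPos H ≤ sigPos M` for the corner `H` of `M`).
-/

noncomputable section

open Module QuadraticMap

namespace Literature.LinearAlgebra.QuadraticForm

variable {V : Type*} [AddCommGroup V] [Module ℝ V]

/-! ## §1 Monotonicity of the positive index of inertia -/

/-- **Monotonicity**: if `B₁ x x ≤ B₂ x x` for every `x`, then `sigPos B₁ ≤ sigPos B₂` (a positive definite subspace
for `B₁` is one for `B₂`). [folklore] [cite: Serre1973, Ch. V §1.3.2] -/
theorem sigPos_mono [FiniteDimensional ℝ V] (B₁ B₂ : LinearMap.BilinForm ℝ V) (h : ∀ x, B₁ x x ≤ B₂ x x) :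
    sigPos B₁.toQuadraticMap ≤ sigPos B₂.toQuadraticMap := by
  obtain ⟨P, hP, hpos⟩ := exists_finrank_eq_sigPos_and_posDef B₁.toQuadraticMap
  rw [← hP]
  refine le_sigPos_of_posDef _ fun x hx ↦ ?_
  have h1 := hpos x hx
  rw [QuadraticMap.restrict_apply, LinearMap.BilinMap.toQuadraticMap_apply] at h1 ⊢
  exact h1.trans_le (h _)

/-- A positive multiple of a form has the same positive index (Sylvester's law of inertia). [cite: Serre1973, Ch. V §1.3.2]
[cite: BrandenHuh2019, §2.2 Lemma 2.9 (3), (4) (dilations `θ ≥ 0`)] -/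
theorem sigPos_smul_of_pos [FiniteDimensional ℝ V] (B : LinearMap.BilinForm ℝ V) {c : ℝ} (hc : 0 < c) :
    sigPos (c • B).toQuadraticMap = sigPos B.toQuadraticMap := by
  apply le_antisymm
  · obtain ⟨P, hP, hpos⟩ := exists_finrank_eq_sigPos_and_posDef (c • B).toQuadraticMap
    rw [← hP]
    refine le_sigPos_of_posDef _ fun x hx ↦ ?_
    have h1 := hpos x hx
    simp only [QuadraticMap.restrict_apply, LinearMap.BilinMap.toQuadraticMap_apply, LinearMap.smul_apply,
      smul_eq_mul] at h1 ⊢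
    exact pos_of_mul_pos_right h1 hc.le
  · obtain ⟨P, hP, hpos⟩ := exists_finrank_eq_sigPos_and_posDef B.toQuadraticMap
    rw [← hP]
    refine le_sigPos_of_posDef _ fun x hx ↦ ?_
    have h1 := hpos x hx
    simp only [QuadraticMap.restrict_apply, LinearMap.BilinMap.toQuadraticMap_apply, LinearMap.smul_apply,
      smul_eq_mul] at h1 ⊢
    exact mul_pos hc h1

/-- `B x y = B y x` for a symmetric form, as a rewrite rule. [cite: ShenfeldVanHandel2019, Lemma 2.9 ("Let `A` be a
symmetric matrix")] -/
theorem symm_apply {B : LinearMap.BilinForm ℝ V} (hB : LinearMap.IsSymm B) (x y : V) : B x y = B y x := hB.eq x y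

/-- `B + ε N` is symmetric when `B` and `N` are. [cite: ShenfeldVanHandel2019, Lemma 2.9 ("Let `A` be a symmetric
matrix")] -/
theorem isSymm_add_smul {B N : LinearMap.BilinForm ℝ V} (hB : LinearMap.IsSymm B) (hN : LinearMap.IsSymm N)
    (ε : ℝ) : LinearMap.IsSymm (B + ε • N) :=
  ⟨fun u v ↦ by
    change (B + ε • N) u v = (B + ε • N) v u
    simp only [LinearMap.add_apply, LinearMap.smul_apply, symm_apply hB u v, symm_apply hN u v]⟩

/-- `B₁ + B₂` is symmetric when `B₁` and `B₂` are. [cite: ShenfeldVanHandel2019, Lemma 2.9 ("Let `A` be a symmetric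
matrix")] -/
theorem isSymm_add {B₁ B₂ : LinearMap.BilinForm ℝ V} (h₁ : LinearMap.IsSymm B₁) (h₂ : LinearMap.IsSymm B₂) :
    LinearMap.IsSymm (B₁ + B₂) :=
  ⟨fun u v ↦ by
    change (B₁ + B₂) u v = (B₁ + B₂) v u
    simp only [LinearMap.add_apply, symm_apply h₁ u v, symm_apply h₂ u v]⟩

/-! ## §2 An isotropic vector outside the radical: `e^⊥` is non-positive -/

/-- `B (w - a z) (w - a z) = B w w - (B w z)² / B z z` for `a = B w z / B z z`. [folklore] -/
private theorem self_sub_proj (B : LinearMap.BilinForm ℝ V) (hB : LinearMap.IsSymm B) {z : V} (hz : B z z ≠ 0)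
    (w : V) : B (w - (B w z / B z z) • z) (w - (B w z / B z z) • z) = B w w - B w z ^ 2 / B z z := by
  have hzw : B z w = B w z := symm_apply hB z w
  simp only [map_sub, map_smul, LinearMap.sub_apply, LinearMap.smul_apply, smul_eq_mul, hzw]
  field_simp
  ring

/-- **An isotropic vector outside the radical has non-positive orthogonal complement** (Shenfeld–van Handel Lemma 2.9,
(3) ⟹ (2), with an isotropic `w`): if `Q` has at most one positive square, `B e e = 0` and `B y₀ e ≠ 0` for some `y₀`,
then `B z z ≤ 0` whenever `B z e = 0`. (Otherwise `z` and `x = e + t y - (proj)`, `B y e = 1`, `t > 0` small, would be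
two `B`-orthogonal vectors of positive square: `B x x = t (2 + t c)`.) This is the quadratic-form content of "`f ≺ g`
forces `Im (g/f) ≥ 0` on `ℋ^n`". [cite: ShenfeldVanHandel2019, Lemma 2.9 (3) ⟹ (2)] [cite: BrandenHuh2019, §2.2
(the relation `≺`, Lemma 2.9)] -/
theorem self_nonpos_of_orthogonal_isotropic [FiniteDimensional ℝ V] (B : LinearMap.BilinForm ℝ V)
    (hB : LinearMap.IsSymm B) (h1 : sigPos B.toQuadraticMap ≤ 1) {e y₀ : V} (he : B e e = 0) (hy₀ : B y₀ e ≠ 0)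
    {z : V} (hz : B z e = 0) : B z z ≤ 0 := by
  by_contra hzz
  push Not at hzz
  -- normalise `y₀` so that `B y e = 1`
  set y : V := (B y₀ e)⁻¹ • y₀ with hy
  have hye : B y e = 1 := by
    rw [hy, map_smul, LinearMap.smul_apply, smul_eq_mul, inv_mul_cancel₀ hy₀]
  have hey : B e y = 1 := by rw [symm_apply hB e y, hye]
  have hez : B e z = 0 := by rw [symm_apply hB e z, hz]
  -- `c := B y y - (B y z)² / B z z` and a positive `t` with `2 + t c > 0`
  set c : ℝ := B y y - B y z ^ 2 / B z z with hc
  obtain ⟨t, ht0, htc⟩ : ∃ t : ℝ, 0 < t ∧ 0 < 2 + t * c := by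
    by_cases hc0 : 0 ≤ c
    · exact ⟨1, one_pos, by nlinarith⟩
    · push Not at hc0
      refine ⟨-c⁻¹, neg_pos.2 (inv_lt_zero.2 hc0), ?_⟩
      rw [neg_mul, inv_mul_cancel₀ hc0.ne]
      norm_num
  -- `w := e + t y`, `x := w - proj_z w`
  set w : V := e + t • y with hw
  have hwz : B w z = t * B y z := by
    rw [hw, map_add, LinearMap.add_apply, map_smul, LinearMap.smul_apply, smul_eq_mul, hez, zero_add]
  have hww : B w w = 2 * t + t ^ 2 * B y y := by
    rw [hw]
    simp only [map_add, map_smul, LinearMap.add_apply, LinearMap.smul_apply, smul_eq_mul, he, hey, hye]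
    ring
  set x : V := w - (B w z / B z z) • z with hx
  have hxz : B x z = 0 := by
    rw [hx, map_sub, LinearMap.sub_apply, map_smul, LinearMap.smul_apply, smul_eq_mul,
      div_mul_cancel₀ _ hzz.ne', sub_self]
  have hxx : B x x = t * (2 + t * c) := by
    rw [hx, self_sub_proj B hB hzz.ne' w, hww, hwz, hc]
    field_simp
    ring
  have hpos : 0 < B x x := by rw [hxx]; exact mul_pos ht0 htc
  exact not_self_pos_of_orthogonal_of_self_pos B hB h1 hzz hxz hpos

/-! ## §3 Sums of forms sharing an isotropic vector (Brändén–Huh Lemma 2.9 (4) for quadratic forms) -/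

/-- **Brändén–Huh Lemma 2.9 (4), quadratic case: "`f ≺ g_1`, `f ≺ g_2` ⟹ `f ≺ θ_1 g_1 + θ_2 g_2`" for a nonzero LINEAR
`f`.** In signature language: let `B₁, B₂` be symmetric with at most one positive square each (the quadratic forms
`g_m + w_{n+1} f`), sharing an isotropic vector `e` (the new variable `w_{n+1}`: no `w_{n+1}²` term) on which they induce
the same nonzero linear functional `B₁ · e = B₂ · e` (the common linear form `f`). Then `B₁ + B₂` has at most one
positive square: both are non-positive on the common hyperplane `e^⊥` (§2), hence so is the sum, and Shenfeld–van
Handel (2) ⟹ (3) (`sigPos_le_one_of_orthogonal_nonpos`) concludes. [cite: BrandenHuh2019, §2.2 Lemma 2.9 (4)]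
[cite: ShenfeldVanHandel2019, Lemma 2.9 (2) ⟺ (3)] -/
theorem sigPos_add_le_one_of_isotropic [FiniteDimensional ℝ V] (B₁ B₂ : LinearMap.BilinForm ℝ V)
    (hB₁ : LinearMap.IsSymm B₁) (hB₂ : LinearMap.IsSymm B₂) (h₁ : sigPos B₁.toQuadraticMap ≤ 1)
    (h₂ : sigPos B₂.toQuadraticMap ≤ 1) {e y₀ : V} (he₁ : B₁ e e = 0) (he₂ : B₂ e e = 0)
    (hfun : ∀ z, B₁ z e = B₂ z e) (hy₀ : B₁ y₀ e ≠ 0) :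
    sigPos (B₁ + B₂).toQuadraticMap ≤ 1 := by
  refine sigPos_le_one_of_orthogonal_nonpos (B₁ + B₂) (w := e) fun z hz ↦ ?_
  rw [LinearMap.add_apply, LinearMap.add_apply, ← hfun] at hz
  have hz1 : B₁ z e = 0 := by linarith
  have hz2 : B₂ z e = 0 := by rw [← hfun]; exact hz1
  rw [LinearMap.add_apply, LinearMap.add_apply]
  exact add_nonpos (self_nonpos_of_orthogonal_isotropic B₁ hB₁ h₁ he₁ hy₀ hz1)
    (self_nonpos_of_orthogonal_isotropic B₂ hB₂ h₂ he₂ (by rwa [← hfun]) hz2)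

/-! ## §4 "Stability is a closed condition": `sigPos (B + εN) ≤ 1` for all `ε > 0` forces `sigPos B ≤ 1` -/

/-- In a positive definite subspace of dimension `≥ 2` there are two `B`-orthogonal vectors of positive square.
[folklore] -/
private theorem exists_orthogonal_pair_of_two_le_sigPos [FiniteDimensional ℝ V] (B : LinearMap.BilinForm ℝ V)
    (h2 : 2 ≤ sigPos B.toQuadraticMap) : ∃ x y : V, 0 < B x x ∧ 0 < B y y ∧ B x y = 0 := by
  obtain ⟨P, hP, hpos⟩ := exists_finrank_eq_sigPos_and_posDef B.toQuadraticMap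
  have hP2 : 2 ≤ finrank ℝ P := by rw [hP]; exact h2
  -- a nonzero `x ∈ P`
  have hPne : (P : Submodule ℝ V) ≠ ⊥ := by
    intro hbot
    rw [hbot, finrank_bot] at hP2
    exact absurd hP2 (by norm_num)
  obtain ⟨x, hxP, hx0⟩ := (Submodule.ne_bot_iff P).1 hPne
  have hxx : 0 < B x x := by
    have h := hpos ⟨x, hxP⟩ (by intro h0; exact hx0 (congrArg Subtype.val h0))
    rwa [QuadraticMap.restrict_apply, LinearMap.BilinMap.toQuadraticMap_apply] at h
  -- a nonzero `y ∈ P` with `B x y = 0`: the kernel of `p ↦ B x p` on `P` is nonzero by a dimension count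
  set ℓ : P →ₗ[ℝ] ℝ := (B x).comp P.subtype with hℓ
  have hr : finrank ℝ (LinearMap.range ℓ) ≤ 1 := (Submodule.finrank_le _).trans (finrank_self ℝ).le
  have hrk := ℓ.finrank_range_add_finrank_ker
  have hker : LinearMap.ker ℓ ≠ ⊥ := by
    intro hbot
    rw [hbot, finrank_bot] at hrk
    omega
  obtain ⟨y, hyk, hy0⟩ := (Submodule.ne_bot_iff _).1 hker
  have hxy : B x y = 0 := by
    have h := LinearMap.mem_ker.1 hyk
    rwa [hℓ, LinearMap.comp_apply, Submodule.subtype_apply] at h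
  have hyy : 0 < B y y := by
    have h := hpos y hy0
    rwa [QuadraticMap.restrict_apply, LinearMap.BilinMap.toQuadraticMap_apply] at h
  exact ⟨x, y, hxx, hyy, hxy⟩

/-- **"Stability is a closed condition"** (Brändén–Huh, proof of Prop. 2.7: "Since stability is a closed condition, it
follows that `lim_{s→0} […]` is stable"), for quadratic forms along a segment: if `B + εN` has at most one positive square
for every `ε > 0`, then so has `B`. (If `x ⊥_B y` had positive squares, then for small `ε > 0` the vectors `x` and
`y - (εN(y,x)/(B+εN)(x,x)) x` would be `(B + εN)`-orthogonal of positive square.) [cite: BrandenHuh2019, §2.2 proof of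
Prop. 2.7 ("stability is a closed condition")] -/
theorem sigPos_le_one_of_forall_pos_add_smul [FiniteDimensional ℝ V] (B N : LinearMap.BilinForm ℝ V)
    (hB : LinearMap.IsSymm B) (hN : LinearMap.IsSymm N)
    (h : ∀ ε : ℝ, 0 < ε → sigPos (B + ε • N).toQuadraticMap ≤ 1) : sigPos B.toQuadraticMap ≤ 1 := by
  by_contra h2
  push Not at h2
  obtain ⟨x, y, hxx, hyy, hxy⟩ := exists_orthogonal_pair_of_two_le_sigPos B h2
  have hyx : B y x = 0 := by rw [symm_apply hB y x, hxy]
  -- a small positive `ε`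
  set K : ℝ := |B y y * N x x| + |N y y * B x x| + |N y y * N x x| + N y x ^ 2 with hK
  have hK0 : 0 ≤ K := by positivity
  set ε : ℝ := min 1 (min (B x x / (2 * (|N x x| + 1))) (B x x * B y y / (2 * (K + 1)))) with hε
  have hε1 : ε ≤ 1 := min_le_left _ _
  have hεA : ε ≤ B x x / (2 * (|N x x| + 1)) := (min_le_right _ _).trans (min_le_left _ _)
  have hεB : ε ≤ B x x * B y y / (2 * (K + 1)) := (min_le_right _ _).trans (min_le_right _ _)
  have hε0 : 0 < ε := by
    rw [hε]
    refine lt_min one_pos (lt_min ?_ ?_) <;> positivity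
  -- `(B + εN) x x = B x x + ε N x x ≥ B x x / 2 > 0`
  have hA : ε * |N x x| ≤ B x x / 2 := by
    calc ε * |N x x| ≤ B x x / (2 * (|N x x| + 1)) * |N x x| := mul_le_mul_of_nonneg_right hεA (abs_nonneg _)
      _ = B x x / 2 * (|N x x| / (|N x x| + 1)) := by field_simp
      _ ≤ B x x / 2 * 1 := by
          refine mul_le_mul_of_nonneg_left ?_ (by positivity)
          rw [div_le_one (by positivity)]
          linarith [abs_nonneg (N x x)]
      _ = B x x / 2 := mul_one _
  have hpx0 : 0 < B x x + ε * N x x := by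
    have : -(ε * |N x x|) ≤ ε * N x x := by
      rw [← mul_neg]
      exact mul_le_mul_of_nonneg_left (neg_abs_le _) hε0.le
    linarith
  set B' : LinearMap.BilinForm ℝ V := B + ε • N with hB'
  have hB's : LinearMap.IsSymm B' := isSymm_add_smul hB hN ε
  have hB'xx : B' x x = B x x + ε * N x x := by
    simp only [hB', LinearMap.add_apply, LinearMap.smul_apply, smul_eq_mul]
  have hB'yx : B' y x = ε * N y x := by
    simp only [hB', LinearMap.add_apply, LinearMap.smul_apply, smul_eq_mul, hyx, zero_add]
  have hB'yy : B' y y = B y y + ε * N y y := by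
    simp only [hB', LinearMap.add_apply, LinearMap.smul_apply, smul_eq_mul]
  -- `y' := y - (B' y x / B' x x) x` is `B'`-orthogonal to `x`
  set y' : V := y - (B' y x / B' x x) • x with hy'
  have hy'x : B' y' x = 0 := by
    rw [hy', map_sub, LinearMap.sub_apply, map_smul, LinearMap.smul_apply, smul_eq_mul,
      div_mul_cancel₀ _ (by rw [hB'xx]; exact hpx0.ne'), sub_self]
  have hy'y' : B' y' y' = (B y y + ε * N y y) - (ε * N y x) ^ 2 / (B x x + ε * N x x) := by
    rw [hy', self_sub_proj B' hB's (by rw [hB'xx]; exact hpx0.ne') y, hB'yy, hB'yx, hB'xx]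
  -- its square is positive: `(Byy + ε Nyy)(Bxx + ε Nxx) - ε² Nyx² = Bxx Byy + ε·[…] ≥ Bxx Byy - εK > 0`
  have hbr : |B y y * N x x + N y y * B x x + ε * (N y y * N x x) - ε * N y x ^ 2| ≤ K := by
    have h3 : |ε * (N y y * N x x)| ≤ |N y y * N x x| := by
      rw [abs_mul, abs_of_pos hε0]
      exact mul_le_of_le_one_left (abs_nonneg _) hε1
    have h4 : |ε * N y x ^ 2| ≤ N y x ^ 2 := by
      rw [abs_mul, abs_of_pos hε0, abs_of_nonneg (sq_nonneg _)]
      exact mul_le_of_le_one_left (sq_nonneg _) hε1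
    calc |B y y * N x x + N y y * B x x + ε * (N y y * N x x) - ε * N y x ^ 2|
        ≤ |B y y * N x x + N y y * B x x + ε * (N y y * N x x)| + |ε * N y x ^ 2| := abs_sub _ _
      _ ≤ |B y y * N x x + N y y * B x x| + |ε * (N y y * N x x)| + |ε * N y x ^ 2| := by
          linarith [abs_add_le (B y y * N x x + N y y * B x x) (ε * (N y y * N x x))]
      _ ≤ |B y y * N x x| + |N y y * B x x| + |ε * (N y y * N x x)| + |ε * N y x ^ 2| := by
          linarith [abs_add_le (B y y * N x x) (N y y * B x x)]
      _ ≤ K := by rw [hK]; linarith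
  have hεK : ε * K ≤ B x x * B y y / 2 := by
    calc ε * K ≤ B x x * B y y / (2 * (K + 1)) * K := mul_le_mul_of_nonneg_right hεB hK0
      _ = B x x * B y y / 2 * (K / (K + 1)) := by field_simp
      _ ≤ B x x * B y y / 2 * 1 := by
          refine mul_le_mul_of_nonneg_left ?_ (by positivity)
          rw [div_le_one (by positivity)]
          linarith
      _ = B x x * B y y / 2 := mul_one _
  have hnum : 0 < (B y y + ε * N y y) * (B x x + ε * N x x) - (ε * N y x) ^ 2 := by
    have hexp : (B y y + ε * N y y) * (B x x + ε * N x x) - (ε * N y x) ^ 2 =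
        B x x * B y y + ε * (B y y * N x x + N y y * B x x + ε * (N y y * N x x) - ε * N y x ^ 2) := by ring
    rw [hexp]
    have hlow : -(ε * K) ≤ ε * (B y y * N x x + N y y * B x x + ε * (N y y * N x x) - ε * N y x ^ 2) := by
      rw [← mul_neg]
      exact mul_le_mul_of_nonneg_left ((neg_le_neg hbr).trans (neg_abs_le _)) hε0.le
    have hpq : 0 < B x x * B y y := mul_pos hxx hyy
    linarith
  have hy'pos : 0 < B' y' y' := by
    rw [hy'y', sub_div' hpx0.ne']
    exact div_pos hnum hpx0
  have hxpos : 0 < B' x x := by rw [hB'xx]; exact hpx0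
  exact not_self_pos_of_orthogonal_of_self_pos B' hB's (h ε hε0) hxpos hy'x hy'pos

/-! ## §5 The bordered matrix `[[H, u], [uᵀ, 0]]`: Brändén–Huh Lemma 2.9 (1) for quadratic forms -/

section Bordered

variable {σ : Type*}

/-- **The bordered matrix `[[H, u], [uᵀ, 0]]`** on `Option σ` (the new index is `none`): the Hessian of the quadratic form
`½ xᵀHx + w_{n+1} · uᵀx` in the variables `x` and the new variable `w_{n+1}` — Brändén–Huh's `g + w_{n+1} f` for a
quadratic `g` and a linear `f`. [cite: BrandenHuh2019, §2.2 (definition of `≺`: "`g + w_{n+1} f`")] -/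
def bordered (H : Matrix σ σ ℝ) (u : σ → ℝ) : Matrix (Option σ) (Option σ) ℝ :=
  Matrix.of fun i j ↦ i.elim (j.elim 0 u) fun a ↦ j.elim (u a) fun b ↦ H a b

/-- The `σ × σ` corner of `[[H, u], [uᵀ, 0]]` is `H`. [cite: BrandenHuh2019, §2.2 ("`g + w_{n+1} f`")] -/
@[simp] theorem bordered_some_some (H : Matrix σ σ ℝ) (u : σ → ℝ) (a b : σ) :
    bordered H u (some a) (some b) = H a b := rfl

/-- The last column of `[[H, u], [uᵀ, 0]]` is `u`. [cite: BrandenHuh2019, §2.2 ("`g + w_{n+1} f`")] -/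
@[simp] theorem bordered_some_none (H : Matrix σ σ ℝ) (u : σ → ℝ) (a : σ) :
    bordered H u (some a) none = u a := rfl

/-- The last row of `[[H, u], [uᵀ, 0]]` is `uᵀ`. [cite: BrandenHuh2019, §2.2 ("`g + w_{n+1} f`")] -/
@[simp] theorem bordered_none_some (H : Matrix σ σ ℝ) (u : σ → ℝ) (b : σ) :
    bordered H u none (some b) = u b := rfl

/-- The corner entry of `[[H, u], [uᵀ, 0]]` is `0` (no `w_{n+1}²` term). [cite: BrandenHuh2019, §2.2 ("`g + w_{n+1} f`")] -/
@[simp] theorem bordered_none_none (H : Matrix σ σ ℝ) (u : σ → ℝ) : bordered H u none none = 0 := rfl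

/-- `[[H, u], [uᵀ, 0]]` is symmetric when `H` is. [cite: BrandenHuh2019, §2.2 (the relation `≺`)] -/
theorem isSymm_bordered {H : Matrix σ σ ℝ} (hH : H.IsSymm) (u : σ → ℝ) : (bordered H u).IsSymm := by
  refine Matrix.IsSymm.ext fun i j ↦ ?_
  cases i <;> cases j <;> simp [hH.apply _ _]

/-- The sum of two bordered matrices. [cite: BrandenHuh2019, §2.2 Lemma 2.9 (4)] -/
theorem bordered_add (H₁ H₂ : Matrix σ σ ℝ) (u₁ u₂ : σ → ℝ) :
    bordered H₁ u₁ + bordered H₂ u₂ = bordered (H₁ + H₂) (u₁ + u₂) := by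
  ext i j
  cases i <;> cases j <;> simp

/-- A scalar multiple of a bordered matrix. [cite: BrandenHuh2019, §2.2 Lemma 2.9 (3), (4)] -/
theorem smul_bordered (c : ℝ) (H : Matrix σ σ ℝ) (u : σ → ℝ) : c • bordered H u = bordered (c • H) (c • u) := by
  ext i j
  cases i <;> cases j <;> simp

/-- **The border map** `(x, t) ↦ x + t a`. [cite: BrandenHuh2019, §2.2 Lemma 2.9 (1)] -/
def borderMap (a : σ → ℝ) : (Option σ → ℝ) →ₗ[ℝ] (σ → ℝ) where
  toFun z := fun i ↦ z (some i) + z none * a i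
  map_add' z z' := by ext i; simp only [Pi.add_apply]; ring
  map_smul' c z := by ext i; simp only [Pi.smul_apply, smul_eq_mul, RingHom.id_apply]; ring

/-- `borderMap a (x, t) = x + t a`, coordinatewise. [cite: BrandenHuh2019, §2.2 Lemma 2.9 (1)] -/
@[simp] theorem borderMap_apply (a : σ → ℝ) (z : Option σ → ℝ) (i : σ) :
    borderMap a z i = z (some i) + z none * a i := rfl

variable [Fintype σ] [DecidableEq σ]

/-- **The quadratic form of the bordered matrix**: for `z = (x, t)`, `z' = (x', t')` (`x = z ∘ some`, `t = z none`),
`zᵀ [[H,u],[uᵀ,0]] z' = xᵀHx' + t' · uᵀx + t · uᵀx'`. [cite: BrandenHuh2019, §2.2 ("`g + w_{n+1} f`")] -/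
theorem toBilin'_bordered (H : Matrix σ σ ℝ) (u : σ → ℝ) (z z' : Option σ → ℝ) :
    Matrix.toBilin' (bordered H u) z z' =
      Matrix.toBilin' H (fun a ↦ z (some a)) (fun a ↦ z' (some a)) +
        z' none * (∑ a, u a * z (some a)) + z none * (∑ a, u a * z' (some a)) := by
  rw [Matrix.toBilin'_apply, Matrix.toBilin'_apply, Fintype.sum_option]
  simp only [Fintype.sum_option, bordered_none_none, bordered_none_some, bordered_some_none, bordered_some_some,
    mul_zero, zero_mul, zero_add, Finset.sum_add_distrib]
  have h1 : ∑ a, z none * u a * z' (some a) = z none * ∑ a, u a * z' (some a) := by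
    rw [Finset.mul_sum]; exact Finset.sum_congr rfl fun a _ ↦ by ring
  have h2 : ∑ a, z (some a) * u a * z' none = z' none * ∑ a, u a * z (some a) := by
    rw [Finset.mul_sum]; exact Finset.sum_congr rfl fun a _ ↦ by ring
  rw [h1, h2]
  ring

/-- `zᵀ [[H,u],[uᵀ,0]] e_{none} = uᵀx`: the functional induced on `e_{none}` is the linear form `u`.
[cite: BrandenHuh2019, §2.2 ("`g + w_{n+1} f`")] -/
theorem toBilin'_bordered_none (H : Matrix σ σ ℝ) (u : σ → ℝ) (z : Option σ → ℝ) :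
    Matrix.toBilin' (bordered H u) z (Pi.single none 1) = ∑ a, u a * z (some a) := by
  rw [toBilin'_bordered]
  have h0 : (fun a : σ ↦ (Pi.single (none : Option σ) (1 : ℝ) : Option σ → ℝ) (some a)) = 0 := by
    ext a; simp
  rw [h0, map_zero, Pi.single_eq_same, one_mul]
  simp

/-- The new basis vector `e = e_{none}` is ISOTROPIC for `[[H,u],[uᵀ,0]]` (no `w_{n+1}²` term).
[cite: BrandenHuh2019, §2.2 ("`g + w_{n+1} f`", `f` linear in the application)] -/
theorem toBilin'_bordered_none_none (H : Matrix σ σ ℝ) (u : σ → ℝ) :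
    Matrix.toBilin' (bordered H u) (Pi.single none 1) (Pi.single none 1) = 0 := by
  rw [toBilin'_bordered_none]
  simp

/-- **Completing the square**: `zᵀ [[H, Ha], [(Ha)ᵀ, 0]] z = (x + t a)ᵀ H (x + t a) - t² · aᵀHa` for symmetric `H`.
[cite: BrandenHuh2019, §2.2 Lemma 2.9 (1) ("`∂_1 f ≺ f`")] -/
theorem toBilin'_bordered_mulVec_self (H : Matrix σ σ ℝ) (hH : H.IsSymm) (a : σ → ℝ) (z : Option σ → ℝ) :
    Matrix.toBilin' (bordered H (H.mulVec a)) z z =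
      Matrix.toBilin' H (borderMap a z) (borderMap a z) - z none ^ 2 * Matrix.toBilin' H a a := by
  rw [toBilin'_bordered]
  set x : σ → ℝ := fun i ↦ z (some i) with hx
  set t : ℝ := z none
  have hbm : borderMap a z = x + t • a := by
    ext i; simp [hx, t]
  have hsymm : Matrix.toBilin' H a x = Matrix.toBilin' H x a := by
    rw [Matrix.toBilin'_apply', Matrix.toBilin'_apply', Matrix.dotProduct_mulVec, ← Matrix.mulVec_transpose, hH.eq,
      dotProduct_comm]
  have hux : ∑ i, H.mulVec a i * x i = Matrix.toBilin' H x a := by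
    rw [Matrix.toBilin'_apply', dotProduct_comm]
    rfl
  rw [hbm, hux]
  simp only [map_add, map_smul, LinearMap.add_apply, LinearMap.smul_apply, smul_eq_mul, hsymm]
  ring

/-- **Brändén–Huh Lemma 2.9 (1) for a quadratic form (`D_a q ≺ q`): bordering `H` by `Ha` does not increase the
positive index** — `sigPos [[H, Ha], [(Ha)ᵀ, 0]] ≤ sigPos H` whenever `aᵀHa ≥ 0` (e.g. `H` with nonnegative entries and
`a ≥ 0`): by completing the square the bordered form is dominated by the pull-back of `H` along `(x,t) ↦ x + ta`.
[cite: BrandenHuh2019, §2.2 Lemma 2.9 (1) ("The derivative `∂_1 f` is stable and `∂_1 f ≺ f`")]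
[cite: Serre1973, Ch. V §1.3.2] -/
theorem sigPos_bordered_mulVec_le (H : Matrix σ σ ℝ) (hH : H.IsSymm) {a : σ → ℝ} (ha : 0 ≤ Matrix.toBilin' H a a) :
    sigPos (Matrix.toBilin' (bordered H (H.mulVec a))).toQuadraticMap ≤
      sigPos (Matrix.toBilin' H).toQuadraticMap := by
  set P : LinearMap.BilinForm ℝ (Option σ → ℝ) := (Matrix.toBilin' H).compl₁₂ (borderMap a) (borderMap a) with hP
  calc sigPos (Matrix.toBilin' (bordered H (H.mulVec a))).toQuadraticMap ≤ sigPos P.toQuadraticMap := by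
        refine sigPos_mono _ _ fun z ↦ ?_
        rw [toBilin'_bordered_mulVec_self H hH a z, hP, LinearMap.compl₁₂_apply]
        nlinarith [sq_nonneg (z none)]
    _ ≤ sigPos (Matrix.toBilin' H).toQuadraticMap :=
        LinearMap.BilinForm.sigPos_le_sigPos_of_comp P _ (borderMap a) fun z z' ↦ by
          rw [hP, LinearMap.compl₁₂_apply]

/-- **The corner of a matrix has no larger positive index**: `sigPos H ≤ sigPos M` for `H = (M_{ab})_{a,b ∈ σ}` the
`σ × σ` corner of `M` on `Option σ` (pull back along `x ↦ (x, 0)`). [cite: Serre1973, Ch. V §1.3.2] -/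
theorem sigPos_submatrix_some_le (M : Matrix (Option σ) (Option σ) ℝ) :
    sigPos (Matrix.toBilin' (M.submatrix some some)).toQuadraticMap ≤ sigPos (Matrix.toBilin' M).toQuadraticMap := by
  set ι : (σ → ℝ) →ₗ[ℝ] (Option σ → ℝ) :=
    { toFun := fun x o ↦ o.elim 0 x
      map_add' := fun x y ↦ by ext o; cases o <;> simp
      map_smul' := fun c x ↦ by ext o; cases o <;> simp } with hι
  refine LinearMap.BilinForm.sigPos_le_sigPos_of_comp _ _ ι fun x y ↦ ?_
  rw [Matrix.toBilin'_apply, Matrix.toBilin'_apply, Fintype.sum_option]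
  simp [hι, Fintype.sum_option]

end Bordered

end Literature.LinearAlgebra.QuadraticForm

end
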